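import Summits.QuantumFields.BalabanUV.T4Continuum.Support.ShellMeasureLinearizedGammaT

/-!
# `T4Continuum.ShellMeasureLinearizedWindowNumbers` — NE7c audit «WINDOW NUMBERS»: THE SIZE OF THE (LR)_j CHART WINDOW OF OUR
# KERNEL — `εw ≤ R²∕(18·L^{d−1})`, the plug's admissible slot radius `r ≤ R²∕(36·L^{d−1})`, `R = 1∕(2816(d+1)L)`; on `T⁴`
# (`d = 4`): `r ≤ 1∕(7 136 870 400·L⁵)`, i.e. `< 5·10⁻¹²` at `L = 2`
(cell `pub-balaban`, sub-cell `t4`, spine estimate NE7c (node U5b); NE7c ROUND-2 crew `t4-ne7c-formalise-*`, seat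
`b2b-balaban-t4-ne7c-formalise-leaf-07` gen 8, own initiative after row S91 (NOTE N-ne7cleaf07g8-1 on the journal∕GAPS);
imports S52 f1 `ShellMeasureLinearizedGammaT` ONLY (for `Mq`, `window_ok`); [folklore] real arithmetic; 0 `def`,
0 `def … : Prop`, 0 sorry, 0 citations)

HONEST FRAMING.  Finite four-torus programme, rung (B)+1 only — NOT infinite volume, NOT a mass gap, NOT the Clay
problem, NOT summit progress; (B), `BetaPertHyp`, (B^μ) not consumed.  NE7c (`T4IndicatorShell.ShellWeightBound`) is NOT
PRINTED and NOT PROVED; «NE7c ⇐ the named binders».  THIS FILE IS A CENSUS OF OUR OWN CONSTANTS — the numbers below are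
artefacts of the kernel's crude bounds (S49 `ShellMeasureAverageAnalytic(B7)`: analyticity radius `R = 1∕(2816(d+1)L)` of
the printed average in the chart from unit-word bounds + Schwarz at `0`; S46's window `9·Mq R M_Q·b·εw ≤ ½` with
`Mq R 1 = 2∕R²`, `b = (Lᵈ∕L)∕(1 − (Lᵈ∕L)·24ε) ≥ L^{d−1}`).  [Balaban1987RG1] p. 267 prints NO number («for U in a small
neighbourhood …»); nothing printed is asserted, quantified or disputed.  NOTHING in the countdown moves; spine PROVED 0∕9.
HONEST DEPENDENCY (cell, verbatim): continuum YM on T⁴ ⇐ BetaPertH ∧ nine spine estimates (0/9 proved); BetaPertH ⇐ (D1) ∧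
(D4) ∧ CAP+tail; G-an2-4 gates asym, D1 and NE2/3/4.

THE POINT.  W-d's (LR)_j END of record (S52 ∕ S91 `realForm_chartData_gammaT(_local)_explicit`) charts the Hermitian
window `‖B‖ < εw⋆ := R²∕(18b + 3R + 1)` (§5: `≤ R²∕(18·L^{d−1})`); the W-d plug (S60 ∕ S91 f3
`slotAC_linearizedWindow_gammaT(_local)`, window parameter `εw`) asks the SLOT's window, read in the chart and dilated by the
analyticity factor `Rad`, to sit inside: `hWr : ‖σ z a‖ + Rad·‖Ψ z (x,0)‖ ≤ r`, `hrε : r < εw`, `hq2 : 9·Mq R 1·b·εw ≤ ½`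
(`⇔ εw ≤ R²∕(36b)`, §1).  Since `b ≥ L^{d−1}` (§1) the plug's `εw` — hence every admissible slot radius `r < εw` — is at
most `R²∕(36·L^{d−1}) = 1∕(36·2816²(d+1)²L^{d+1})` (§2); on `T⁴` this is `1∕(7 136 870 400·L⁵)` — `< 5·10⁻¹²` at `L = 2`,
`< 6·10⁻¹³` at `L = 3` (§3).  READING (honest): the slot's chart variable is the two-block bond function of the step's
deviation field, whose window radius is WALL §2b row 2's `S ∼ c₀Mε_j` (η-free); so the plug carries the COUPLING CEILING
`c₀Mε_j·Rad ≲ R²∕(36L^{d−1})` of TYPE «`ε_j = g_j p₀(g_j)` small» — K-UNIFORM, η-FREE, VOLUME-FREE (d, L only), hence NOT a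
wall item, but numerically the SMALLEST ceiling in the node's census (~10⁻¹¹∕(c₀M) at d = 4, L = 2) and an artefact of OUR
constant `2816(d+1)L`, improvable by a sharper analyticity radius for (15).  SCOPE: the number binds the W-d PLUG road
(S60 ∕ S91 f3, host = S33 f1's END-II over the (LR)_j chart); the END-II-final OF RECORD (S80 f3
`…_assembled_decay`, the LANDAU chart of B11) carries B11's radii `r_Φ`, `a₃`, `R_C` as displayed binders WITHOUT numbers and
is unaffected.  Recorded so that the census says a NUMBER where the tree has one.
-/

noncomputable section

namespace Summit.QuantumFields.BalabanUV.T4Continuum.ShellMeasureLinearizedWindowNumbers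

open Summit.QuantumFields.BalabanUV.Beta.LinearizingChange267FromQ (Mq)
open ShellMeasureLinearizedGammaT (window_ok)

/-! ## §1 The window condition of the plug as a radius bound; `b ≥ L^{d−1}` -/

/-- `Mq R 1 = 2∕R²`. [folklore] -/
theorem Mq_one (R : ℝ) : Mq R 1 = 2 / R ^ 2 := by unfold Mq; ring

/-- **THE PLUG's WINDOW CONDITION IS A RADIUS BOUND**: for `R > 0`, `b > 0`:
`9·Mq R 1·b·r ≤ ½ ⇔ r ≤ R²∕(36b)`. [folklore] -/
theorem hq2_iff {R b r : ℝ} (hR : 0 < R) (hb : 0 < b) :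
    9 * Mq R 1 * b * r ≤ 1 / 2 ↔ r ≤ R ^ 2 / (36 * b) := by
  have hR2 : 0 < R ^ 2 := by positivity
  have key : 9 * Mq R 1 * b * r = (r * (36 * b)) / R ^ 2 / 2 := by rw [Mq_one]; field_simp; ring
  rw [key, le_div_iff₀ (by positivity : (0 : ℝ) < 36 * b), div_le_iff₀ (by norm_num : (0 : ℝ) < 2),
    div_le_iff₀ hR2]
  constructor <;> intro h <;> linarith

/-- **`b ≥ Lᵈ∕L`**: the Neumann factor `b = (Lᵈ∕L)∕(1 − (Lᵈ∕L)·24ε)` is at least `Lᵈ∕L` under `0 ≤ ε` and the budget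
`(Lᵈ∕L)·24ε < 1`. [folklore] -/
theorem b_ge {L d : ℕ} (hL : 0 < L) {ε : ℝ} (hε : 0 ≤ ε) (hbud : (L : ℝ) ^ d / L * (24 * ε) < 1) :
    (L : ℝ) ^ d / L ≤ ((L : ℝ) ^ d / L) / (1 - (L : ℝ) ^ d / L * (24 * ε)) := by
  have hLr : (0 : ℝ) < L := by exact_mod_cast hL
  have ha : 0 ≤ (L : ℝ) ^ d / L := by positivity
  have h1 : 0 < 1 - (L : ℝ) ^ d / L * (24 * ε) := by linarith
  rw [le_div_iff₀ h1]
  nlinarith [mul_nonneg (mul_nonneg ha ha) hε]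

/-- `Lᵈ∕L = L^{d−1}` for `1 ≤ d`, `0 < L`. [folklore] -/
theorem pow_div_eq {L d : ℕ} (hL : 0 < L) (hd : 1 ≤ d) : (L : ℝ) ^ d / L = (L : ℝ) ^ (d - 1) := by
  have hLr : (L : ℝ) ≠ 0 := by exact_mod_cast hL.ne'
  obtain ⟨k, rfl⟩ := Nat.exists_eq_add_of_le hd
  rw [Nat.add_sub_cancel_left, pow_add, pow_one]
  field_simp

/-! ## §2 The admissible slot radius of the plug: `r ≤ R²∕(36·L^{d−1})`, `R = 1∕(2816(d+1)L)` -/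

/-- **THE PLUG's WINDOW PARAMETER** (S60∕S91-f3's `hq2` on `εw`, here called `r`; every slot radius `< εw` by `hrε`
obeys the same bound): under the budget and `0 ≤ ε`, `r ≤ R²∕(36·(Lᵈ∕L))` with `R = 1∕(2816(d+1)L)`. [folklore] -/
theorem slotRadius_le {L d : ℕ} (hL : 0 < L) {ε r : ℝ} (hε : 0 ≤ ε) (hbud : (L : ℝ) ^ d / L * (24 * ε) < 1)
    (hq2 : 9 * Mq (1 / (2816 * ((d : ℝ) + 1) * L)) 1 *
      (((L : ℝ) ^ d / L) / (1 - (L : ℝ) ^ d / L * (24 * ε))) * r ≤ 1 / 2) :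
    r ≤ (1 / (2816 * ((d : ℝ) + 1) * L)) ^ 2 / (36 * ((L : ℝ) ^ d / L)) := by
  have hLr : (0 : ℝ) < L := by exact_mod_cast hL
  have hR : (0 : ℝ) < 1 / (2816 * ((d : ℝ) + 1) * L) := by positivity
  have ha : 0 < (L : ℝ) ^ d / L := by positivity
  have hbge := b_ge (d := d) hL hε hbud
  have hb : 0 < ((L : ℝ) ^ d / L) / (1 - (L : ℝ) ^ d / L * (24 * ε)) := lt_of_lt_of_le ha hbge
  have h := (hq2_iff hR hb).1 hq2
  exact h.trans (div_le_div_of_nonneg_left (by positivity) (by positivity) (by nlinarith))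

/-- … explicitly: `r ≤ 1∕(36·2816²·(d+1)²·L²·(Lᵈ∕L))`. [folklore] -/
theorem slotRadius_le_explicit {L d : ℕ} (hL : 0 < L) {ε r : ℝ} (hε : 0 ≤ ε) (hbud : (L : ℝ) ^ d / L * (24 * ε) < 1)
    (hq2 : 9 * Mq (1 / (2816 * ((d : ℝ) + 1) * L)) 1 *
      (((L : ℝ) ^ d / L) / (1 - (L : ℝ) ^ d / L * (24 * ε))) * r ≤ 1 / 2) :
    r ≤ 1 / (36 * 2816 ^ 2 * ((d : ℝ) + 1) ^ 2 * (L : ℝ) ^ 2 * ((L : ℝ) ^ d / L)) := by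
  have hLr : (0 : ℝ) < L := by exact_mod_cast hL
  refine (slotRadius_le hL hε hbud hq2).trans (le_of_eq ?_)
  field_simp

/-! ## §3 On `T⁴`: `r ≤ 1∕(7 136 870 400·L⁵)`; `< 5·10⁻¹²` at `L = 2`, `< 6·10⁻¹³` at `L = 3` -/

/-- **ON `T⁴` (`d = 4`)**: the plug's window parameter (hence every slot radius below it) is `≤ 1∕(7 136 870 400·L⁵)`
(`36·2816²·25 = 7 136 870 400`). [folklore] -/
theorem slotRadius_le_T4 {L : ℕ} (hL : 0 < L) {ε r : ℝ} (hε : 0 ≤ ε) (hbud : (L : ℝ) ^ 4 / L * (24 * ε) < 1)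
    (hq2 : 9 * Mq (1 / (2816 * ((4 : ℕ) + 1 : ℝ) * L)) 1 *
      (((L : ℝ) ^ 4 / L) / (1 - (L : ℝ) ^ 4 / L * (24 * ε))) * r ≤ 1 / 2) :
    r ≤ 1 / (7136870400 * (L : ℝ) ^ 5) := by
  have h := slotRadius_le_explicit (d := 4) hL hε hbud hq2
  have e : (36 : ℝ) * 2816 ^ 2 * ((4 : ℕ) + 1 : ℝ) ^ 2 * (L : ℝ) ^ 2 * ((L : ℝ) ^ (4 - 1)) = 7136870400 * (L : ℝ) ^ 5 := by
    push_cast; ring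
  rwa [pow_div_eq hL (by norm_num), e] at h

/-- **AT `L = 2`**: `r ≤ 1∕228 379 852 800 < 5·10⁻¹²`. [folklore] -/
theorem slotRadius_lt_L2 {ε r : ℝ} (hε : 0 ≤ ε) (hbud : ((2 : ℕ) : ℝ) ^ 4 / (2 : ℕ) * (24 * ε) < 1)
    (hq2 : 9 * Mq (1 / (2816 * ((4 : ℕ) + 1 : ℝ) * (2 : ℕ))) 1 *
      ((((2 : ℕ) : ℝ) ^ 4 / (2 : ℕ)) / (1 - ((2 : ℕ) : ℝ) ^ 4 / (2 : ℕ) * (24 * ε))) * r ≤ 1 / 2) :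
    r < 5 / 10 ^ 12 := by
  have h := slotRadius_le_T4 (L := 2) (by norm_num) hε hbud hq2
  refine h.trans_lt ?_
  norm_num

/-- **AT `L = 3`**: `r ≤ 1∕(7 136 870 400·243) < 6·10⁻¹³`. [folklore] -/
theorem slotRadius_lt_L3 {ε r : ℝ} (hε : 0 ≤ ε) (hbud : ((3 : ℕ) : ℝ) ^ 4 / (3 : ℕ) * (24 * ε) < 1)
    (hq2 : 9 * Mq (1 / (2816 * ((4 : ℕ) + 1 : ℝ) * (3 : ℕ))) 1 *
      ((((3 : ℕ) : ℝ) ^ 4 / (3 : ℕ)) / (1 - ((3 : ℕ) : ℝ) ^ 4 / (3 : ℕ) * (24 * ε))) * r ≤ 1 / 2) :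
    r < 6 / 10 ^ 13 := by
  have h := slotRadius_le_T4 (L := 3) (by norm_num) hε hbud hq2
  refine h.trans_lt ?_
  norm_num

/-! ## §4 NON-VACUITY: the window is not empty — S52 f1's `window_ok` radius -/

/-- **THE BOUND OF §2 IS THE ACTUAL SIZE, NOT SLACK**: S52 f1's chosen END window `εw := R²∕(18b + 3R + 1)`
(`window_ok`) is positive and meets the window condition in its `< 1` form — the kernel's (LR)_j windows ARE of size
`≈ R²∕(18b)`, about twice the plug's `r`-ceiling `R²∕(36b)` of §2 (which asks the `≤ ½` form). [folklore] -/
theorem window_nonvacuous {R b : ℝ} (hR : 0 < R) (hb : 0 ≤ b) :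
    9 * Mq R 1 * b * (R ^ 2 / (18 * b + 3 * R + 1)) < 1 ∧ 0 < R ^ 2 / (18 * b + 3 * R + 1) :=
  ⟨(window_ok hR hb).1, by positivity⟩

/-! ## §5 The END's own chart window `εw = R²∕(18b + 3R + 1)` (S52∕S91 `_explicit`): `≤ R²∕(18·L^{d−1})`, `< 10⁻¹¹` on T⁴ at L = 2 -/

/-- **THE (LR)_j END's CHART WINDOW**: S52∕S91's chosen `εw = R²∕(18b + 3R + 1)` is at most `R²∕(18·(Lᵈ∕L))`
(`b ≥ Lᵈ∕L`, `3R + 1 ≥ 0`). [folklore] -/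
theorem chartWindow_le {L d : ℕ} (hL : 0 < L) {ε : ℝ} (hε : 0 ≤ ε) (hbud : (L : ℝ) ^ d / L * (24 * ε) < 1) :
    (1 / (2816 * ((d : ℝ) + 1) * L)) ^ 2 /
        (18 * (((L : ℝ) ^ d / L) / (1 - (L : ℝ) ^ d / L * (24 * ε))) + 3 * (1 / (2816 * ((d : ℝ) + 1) * L)) + 1)
      ≤ (1 / (2816 * ((d : ℝ) + 1) * L)) ^ 2 / (18 * ((L : ℝ) ^ d / L)) := by
  have hLr : (0 : ℝ) < L := by exact_mod_cast hL
  have hR : (0 : ℝ) < 1 / (2816 * ((d : ℝ) + 1) * L) := by positivity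
  have ha : 0 < (L : ℝ) ^ d / L := by positivity
  have hbge := b_ge (d := d) hL hε hbud
  exact div_le_div_of_nonneg_left (by positivity) (by positivity) (by nlinarith)

/-- **ON `T⁴` AT `L = 2`**: the END's chart window is `< 10⁻¹¹` (exactly `≤ 1∕114 189 926 400`). [folklore] -/
theorem chartWindow_lt_L2 {ε : ℝ} (hε : 0 ≤ ε) (hbud : ((2 : ℕ) : ℝ) ^ 4 / (2 : ℕ) * (24 * ε) < 1) :
    (1 / (2816 * ((4 : ℕ) + 1 : ℝ) * (2 : ℕ))) ^ 2 /
        (18 * ((((2 : ℕ) : ℝ) ^ 4 / (2 : ℕ)) / (1 - ((2 : ℕ) : ℝ) ^ 4 / (2 : ℕ) * (24 * ε))) +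
          3 * (1 / (2816 * ((4 : ℕ) + 1 : ℝ) * (2 : ℕ))) + 1) < 1 / 10 ^ 11 := by
  have h := chartWindow_le (d := 4) (L := 2) (by norm_num) hε hbud
  refine h.trans_lt ?_
  norm_num

/-! ## §6 DECIMALS FOR WALL §2b ROW `S` (owner g34's request, R-ne7cp1-g34-2 (e)): `R`, `Mq R 1`, the Neumann budget and
the END's window `εw⋆` at `d = 4`, `L = 2, 3`

THE LINE TO QUOTE.  W-d window (S52∕S91 `realForm_chartData_gammaT(_local)_explicit`, `d = 4`): **L = 2**: `R = 1∕28160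
≈ 3.551·10⁻⁵`, `Mq R 1 = 2∕R² = 1 585 971 200`, Neumann budget `(Lᵈ∕L)·24ε < 1 ⇔ ε < 1∕192 ≈ 5.21·10⁻³` (with the loop
regime `ε ≤ 1∕8`), `b = 8∕(1 − 192ε)`, **`εw⋆ = R²∕(18b + 3R + 1) = 1∕114 982 996 480 ≈ 8.697·10⁻¹² at ε = 0`**, smaller
for `ε > 0` (always `≤ R²∕144 ≈ 8.76·10⁻¹²`); the plug's window `εw ≤ R²∕(36b) ≤ 1∕228 379 852 800 ≈ 4.379·10⁻¹²`, every
slot radius `r < εw`.  **L = 3**: `R = 1∕42240 ≈ 2.367·10⁻⁵`, `Mq R 1 = 3 568 435 200`, budget `ε < 1∕648 ≈ 1.54·10⁻³`,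
`εw⋆(ε = 0) = 1∕868 914 097 920 ≈ 1.151·10⁻¹²`, plug `≤ 5.77·10⁻¹³`.  (Kernel: the six theorems below; second engine:
exact rationals.) -/

/-- `R = 1∕28160` on `T⁴` at `L = 2`. [folklore] -/
theorem R_T4_L2 : (1 : ℝ) / (2816 * ((4 : ℕ) + 1 : ℝ) * (2 : ℕ)) = 1 / 28160 := by norm_num

/-- `R = 1∕42240` on `T⁴` at `L = 3`. [folklore] -/
theorem R_T4_L3 : (1 : ℝ) / (2816 * ((4 : ℕ) + 1 : ℝ) * (3 : ℕ)) = 1 / 42240 := by norm_num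

/-- `Mq R 1 = 2∕R² = 1 585 971 200` at `L = 2`; `= 3 568 435 200` at `L = 3`. [folklore] -/
theorem Mq_T4 : Mq (1 / 28160) 1 = 1585971200 ∧ Mq (1 / 42240) 1 = 3568435200 := by
  constructor <;> (rw [Mq_one]; norm_num)

/-- the Neumann budget `(Lᵈ∕L)·24ε < 1` on `T⁴`: `⇔ ε < 1∕192` at `L = 2`, `⇔ ε < 1∕648` at `L = 3`. [folklore] -/
theorem budget_T4_iff (ε : ℝ) :
    (((2 : ℕ) : ℝ) ^ 4 / (2 : ℕ) * (24 * ε) < 1 ↔ ε < 1 / 192) ∧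
      (((3 : ℕ) : ℝ) ^ 4 / (3 : ℕ) * (24 * ε) < 1 ↔ ε < 1 / 648) := by
  constructor <;> (push_cast; constructor <;> intro h <;> linarith)

/-- **THE END's WINDOW AT `ε = 0`, `d = 4`, `L = 2`: `εw⋆ = 1∕114 982 996 480`, `8.69·10⁻¹² < εw⋆ < 8.70·10⁻¹²`.** [folklore] -/
theorem chartWindow_T4_L2_zero :
    (1 / (2816 * ((4 : ℕ) + 1 : ℝ) * (2 : ℕ))) ^ 2 /
        (18 * ((((2 : ℕ) : ℝ) ^ 4 / (2 : ℕ)) / (1 - ((2 : ℕ) : ℝ) ^ 4 / (2 : ℕ) * (24 * 0))) +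
          3 * (1 / (2816 * ((4 : ℕ) + 1 : ℝ) * (2 : ℕ))) + 1) = 1 / 114982996480 ∧
      (869 : ℝ) / 10 ^ 14 < 1 / 114982996480 ∧ (1 : ℝ) / 114982996480 < 870 / 10 ^ 14 := by
  refine ⟨?_, by norm_num, by norm_num⟩
  norm_num

/-- **THE END's WINDOW AT `ε = 0`, `d = 4`, `L = 3`: `εw⋆ = 1∕868 914 097 920`, `1.150·10⁻¹² < εw⋆ < 1.151·10⁻¹²`.**
[folklore] -/
theorem chartWindow_T4_L3_zero :
    (1 / (2816 * ((4 : ℕ) + 1 : ℝ) * (3 : ℕ))) ^ 2 /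
        (18 * ((((3 : ℕ) : ℝ) ^ 4 / (3 : ℕ)) / (1 - ((3 : ℕ) : ℝ) ^ 4 / (3 : ℕ) * (24 * 0))) +
          3 * (1 / (2816 * ((4 : ℕ) + 1 : ℝ) * (3 : ℕ))) + 1) = 1 / 868914097920 ∧
      (1150 : ℝ) / 10 ^ 15 < 1 / 868914097920 ∧ (1 : ℝ) / 868914097920 < 1151 / 10 ^ 15 := by
  refine ⟨?_, by norm_num, by norm_num⟩
  norm_num

end Summit.QuantumFields.BalabanUV.T4Continuum.ShellMeasureLinearizedWindowNumbers

end
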